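import Literature.AlgebraicGeometry.Resolution.RelativeCurveValuativeInputCharP
import Literature.AlgebraicGeometry.Resolution.RelativeCurveValuativeInputCharZero
import Literature.AlgebraicGeometry.Resolution.RelativeCurveSmoothFibreAssembly
import Literature.AlgebraicGeometry.Resolution.HenselizedFunctionFieldsReduction
import HarnessLib

/-!
# Temkin's Thm. 3.3.1 (smooth-fibre case) from henselian rationality over a perfect split base and the algebraization

Topic: `Literature/AlgebraicGeometry/Resolution` (valued function fields). M. Temkin, *Inseparable
local uniformization*, J. Algebra 373 (2013) = arXiv:0804.1554v3, Thm. 3.3.1 (tree: the named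
fact `Temkin2013RelativeCurveSmoothFibre`, `InseparableLocalUniformizationCurvesStepOne.lean`).
`Temkin2013RelativeCurveSmoothFibre.of_inputs` (`RelativeCurveSmoothFibreAssembly.lean`) reduces
the fact to its valuative input (J1) and its algebraization (J2). This file closes (J1) up to
the single valuation-theoretic statement

> **(HR)** (Temkin 2013, Thm. 3.2.3, Step 1, henselian rendering; = Kuhlmann 2019, Prop. 5.2 /
> Thm. 1.3 over a perfect henselian rank-one ground field, pulled down through the tame
> extensions of the ground field, Kuhlmann–Vlahu 2014, §14): for `(Ω, V)` algebraically closed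
> of characteristic `p > 0` = residue characteristic and `C ≤ F ≤ Ω` with `C` perfect,
> henselian, of rank one, `F|C` finitely and separably generated of transcendence degree `1`,
> immediate, and `C` algebraically closed in `F^h`: `F ≤ C(x)^h` for some `x ∈ F`
> transcendental over `C`

— in residue characteristic `0` (J1) is `valuativeInput_of_ringExpChar_eq_one`
(`RelativeCurveValuativeInputCharZero.lean`), in characteristic `p` it is
`valuativeInput_charP_of_henselianRational` (`RelativeCurveValuativeInputCharP.lean`) — and
records the resulting reduction of the fact:

* `valuativeInput_of_henselianRational` — **(HR) ⇒ (J1)** (all characteristics) — PROVED;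
* `Temkin2013RelativeCurveSmoothFibre.of_henselianRational` — **(HR) ⇒ (J2) ⇒
  `Temkin2013RelativeCurveSmoothFibre`** — PROVED.

(HR) and (J2) are explicit hypotheses (inline propositions, not named facts); (HR) with the
extra hypothesis "no proper tame extension of `C`" is the tree's
`henselianRational_of_perfect_of_forall_isAlgebraic_mem` (`HenselianRationalityPerfectSplit.lean`).

## Sources

* M. Temkin, arXiv:0804.1554v3: Thm. 3.3.1 and its proof (Steps 1–4), Thms. 3.2.3, 3.2.4,
  3.2.6 and their proofs (pp. 41–45). [Temkin2013]
* F.-V. Kuhlmann, Israel J. Math. 234 (2019) = arXiv:1701.05508, Thm. 1.3, Prop. 5.2.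
  [Kuhlmann2019]
* F.-V. Kuhlmann, I. Vlahu, Math. Z. 276 (2014) = arXiv:1304.0200, Thm. 11.1, §14.
  [KuhlmannVlahu2014]
-/

noncomputable section

open IsLocalRing

namespace Literature.AlgebraicGeometry.Resolution

universe u

/-- **(HR) ⇒ (J1).** The valuative input (J1) of `Temkin2013RelativeCurveSmoothFibre.of_inputs`,
in all (equal) characteristics, from henselian rationality over perfect henselian split bases of
rank one in characteristic `p` (hypothesis `HR`, module docstring).
[cite: Temkin2013, Thm. 3.3.1 (proof, Step 2) with Thms. 3.2.3, 3.2.6 (proofs, Step 2)] -/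
theorem valuativeInput_of_henselianRational
    (HR : ∀ (Ω : Type u) [Field Ω] [IsAlgClosed Ω] (V : ValuationSubring Ω) (p : ℕ)
      [Fact p.Prime] [CharP Ω p] [CharP (ResidueField V) p] (C F : Subfield Ω),
      IsHenselianField C (V.comap (algebraMap C Ω)) →
      (∀ y ∈ C, ∃ b ∈ C, b ^ p = y) → IsRankOne V C → C ≤ F → FGOver C F →
      SeparablyGeneratedOver C F →
      (∃ t ∈ F, Transcendental C t ∧
        ∀ z ∈ F, IsAlgebraic (IntermediateField.adjoin C ({t} : Set Ω)) z) →
      IsImmediateOver V C F → (∀ a ∈ henselization V F, IsAlgebraic C a → a ∈ C) →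
      ∃ x ∈ F, Transcendental C x ∧ F ≤ henselization V (Subfield.closure ((C : Set Ω) ∪ {x}))) :
    ∀ (Ω : Type u) [Field Ω] [IsAlgClosed Ω] (V : ValuationSubring Ω) (k K₁ : Subfield Ω),
      k ≤ K₁ → IsRankOneValued V k → ringExpChar (ResidueField V) = ringExpChar Ω →
      FGOver k K₁ → SeparablyGeneratedOver k K₁ →
      (∃ t ∈ K₁, Transcendental k t ∧
        ∀ z ∈ K₁, IsAlgebraic (IntermediateField.adjoin k ({t} : Set Ω)) z) →
      IsValueTorsionOver V k K₁ → IsResiduallyAlgebraicOver V k K₁ →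
      ∃ (S Y : Finset Ω) (t : Ω), (∀ s ∈ S, ∃ n : ℕ, s ^ (ringExpChar Ω) ^ n ∈ k) ∧
        (∀ y ∈ Y, IsSeparable (Subfield.closure ((k : Set Ω) ∪ ↑S)) y) ∧
        t ∈ K₁ ⊔ Subfield.closure ((k : Set Ω) ∪ ↑S) ∧ t ∈ V ∧ Transcendental k t ∧
        (↑Y : Set Ω) ⊆ henselization V (K₁ ⊔ Subfield.closure ((k : Set Ω) ∪ ↑S)) ∧
        K₁ ≤ henselization V (Subfield.closure ((k : Set Ω) ∪ ↑S ∪ ↑Y ∪ {t})) := by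
  intro Ω _ _ V k K₁ hkK₁ hr1 hchar hfg _hsg h1 hvt hra
  by_cases hq : ringExpChar Ω = 1
  · exact valuativeInput_of_ringExpChar_eq_one V k K₁ hkK₁ hchar hq hfg h1 hvt hra
  · -- characteristic `p > 0`
    set p : ℕ := ringExpChar Ω with hpdef
    have hexp : ExpChar Ω p := ringExpChar.expChar Ω
    have hp : p.Prime := (expChar_is_prime_or_one Ω p).resolve_right hq
    haveI : Fact p.Prime := ⟨hp⟩
    haveI : CharP Ω p := charP_of_expChar_of_prime (h := hexp) p hp
    haveI : CharP (ResidueField V) p :=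
      charP_of_expChar_of_prime (h := ringExpChar.of_eq hchar) p hp
    exact valuativeInput_charP_of_henselianRational V p (fun C F => HR Ω V p C F) k K₁ hkK₁ hr1
      hfg h1 hvt hra

set_option maxHeartbeats 800000 in
/-- **`Temkin2013RelativeCurveSmoothFibre` from (HR) and the algebraization (J2)** (the latter
verbatim as in `Temkin2013RelativeCurveSmoothFibre.of_inputs`).
[cite: Temkin2013, Thm. 3.3.1 (proof, Steps 1–4) with Thms. 3.2.3, 3.2.4, 3.2.6] -/
theorem Temkin2013RelativeCurveSmoothFibre.of_henselianRational
    (HR : ∀ (Ω : Type u) [Field Ω] [IsAlgClosed Ω] (V : ValuationSubring Ω) (p : ℕ)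
      [Fact p.Prime] [CharP Ω p] [CharP (ResidueField V) p] (C F : Subfield Ω),
      IsHenselianField C (V.comap (algebraMap C Ω)) →
      (∀ y ∈ C, ∃ b ∈ C, b ^ p = y) → IsRankOne V C → C ≤ F → FGOver C F →
      SeparablyGeneratedOver C F →
      (∃ t ∈ F, Transcendental C t ∧
        ∀ z ∈ F, IsAlgebraic (IntermediateField.adjoin C ({t} : Set Ω)) z) →
      IsImmediateOver V C F → (∀ a ∈ henselization V F, IsAlgebraic C a → a ∈ C) →
      ∃ x ∈ F, Transcendental C x ∧ F ≤ henselization V (Subfield.closure ((C : Set Ω) ∪ {x})))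
    (hJ2 : ∀ (k K : Type u) [Field k] [Field K] [Algebra k K]
      (Ok : ValuationSubring k) (O : ValuationSubring K),
      ringChar (ResidueField Ok) = ringChar k →
      O.comap (algebraMap k K) = Ok → ringKrullDim Ok = 1 → ringKrullDim O = 1 →
      (⊤ : IntermediateField k K).FG → Algebra.trdeg k K = 1 →
      IsValueTorsionOver O (algebraMap k K).fieldRange ⊤ →
      IsResiduallyAlgebraicOver O (algebraMap k K).fieldRange ⊤ →
      ∀ A : Subring K, IsAffineNormalizedModel O (Ok.toSubring.map (algebraMap k K)) A →
      Algebra.Smooth k (Algebra.adjoin k (A : Set K)) →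
      ∀ (L₁ : Type u) [Field L₁] [Algebra K L₁] [Algebra k L₁] [IsScalarTower k K L₁],
      FiniteDimensional K L₁ →
      ∀ O₁ : ValuationSubring L₁, O₁.comap (algebraMap K L₁) = O →
      Algebra.Smooth k (Algebra.adjoin k (nrIn (A.map (algebraMap K L₁)) : Set L₁)) →
      ∀ (Ω : Type u) [Field Ω] [IsAlgClosed Ω] [Algebra L₁ Ω] [Algebra K Ω] [Algebra k Ω]
        [IsScalarTower K L₁ Ω] [IsScalarTower k L₁ Ω] [IsScalarTower k K Ω]
        (V : ValuationSubring Ω), V.comap (algebraMap L₁ Ω) = O₁ →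
      ∀ (Y : Finset Ω), (∀ y ∈ Y, IsSeparable k y) →
        (↑Y : Set Ω) ⊆ henselization V (algebraMap L₁ Ω).fieldRange →
      ∀ x : L₁, x ∈ O₁ → Transcendental k (algebraMap L₁ Ω x) →
        (algebraMap L₁ Ω).fieldRange ≤ henselization V
          (Subfield.closure (Set.range (algebraMap k Ω) ∪ ↑Y ∪ {algebraMap L₁ Ω x})) →
      Temkin2013RelativeCurveConclusion k K Ok O A L₁ O₁) :
    Temkin2013RelativeCurveSmoothFibre.{u} :=
  Temkin2013RelativeCurveSmoothFibre.of_inputs (valuativeInput_of_henselianRational HR) hJ2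

end Literature.AlgebraicGeometry.Resolution

end
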